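import Literature.AlgebraicGeometry.HodgeTheory.AbelianVarietyPullbackAlgebraicClasses
import Literature.AlgebraicGeometry.Motives.AbelianVarietyProjectiveChart

/-!
# Crux `HodgeAbelianVarieties` (stmt-HodgeConjecture-1333), line `cm-pivot-andre` — stub `stub_homPullback`

The registered stub `stub_homPullback : HomPullback` of the skeleton
`Cruxes/HodgeAbelianVarieties/Lines/cm_pivot_andre.lean` (and, byte-identically, stub 3 of the
strategist's birth skeleton for stmt-HodgeConjecture-3052 `CMAbelianHodge`): pull-back along a
homomorphism `f : A ⟶ B` of complex abelian varieties carries `algebraicClasses B.X p = Nᵖ H²ᵖ(B(ℂ); ℂ)`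
into `algebraicClasses A.X p`. In print: contravariance of the cycle class map for morphisms of
non-singular varieties (Fulton, *Intersection Theory*, Cor. 19.2 (b); Voisin, *Hodge Theory II*,
Prop. 9.21 (i)). On the tree's support carrier this is the Literature theorem
`Literature.AlgebraicGeometry.HodgeTheory.map_mem_algebraicClasses_of_abelianVariety` (pull-back along ANY
morphism from a smooth projective variety to an abelian variety, by Kleiman's moving-by-translates:
`g = i_0 ≫ μ_g` with `μ_g` flat, translations act trivially on cohomology, a general slice of an
algebraic class is algebraic), applied with source the abelian variety `A` (smooth projective by
`AbelianVariety.isSmoothProjective_holds`, Görtz–Wedhorn 27.174) and the underlying scheme morphism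
`f.hom.hom.hom : A.X ⟶ B.X` of the homomorphism `f`.
-/

set_option linter.dupNamespace false

noncomputable section

namespace Summit.HodgeConjecture.HodgeConjecture.Theorems.HodgeAbelianVarieties.CMPivotAndre

open CategoryTheory
open Literature.AlgebraicGeometry Literature.AlgebraicGeometry.Motives Literature.AlgebraicGeometry.HodgeTheory

/-- `HomPullback` — the registered stub signature of `Lines/cm_pivot_andre.lean`, VERBATIM: pull-back along a
homomorphism of complex abelian varieties preserves `algebraicClasses`. Local notation keyed by the
skeleton's name for the statement (so that the theorem header below is literally the registered one). -/
local notation3 (prettyPrint := false) "HomPullback" =>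
  ∀ (A B : AbelianVariety ℂ) (f : A ⟶ B) (p : ℕ) (a : complexBetti B.X (2 * p)),
    a ∈ algebraicClasses B.X p → complexBetti.map f.hom.hom.hom (2 * p) a ∈ algebraicClasses A.X p

/-- **Stub 3 of line `cm-pivot-andre` — pull-backs of algebraic classes along homomorphisms of complex
abelian varieties are algebraic**: for a homomorphism `f : A ⟶ B` of abelian varieties over `ℂ` and
`a ∈ algebraicClasses B.X p = Nᵖ H²ᵖ(B(ℂ); ℂ)`, `f^* a ∈ algebraicClasses A.X p`. The registered signature
`HomPullback` of `Cruxes/HodgeAbelianVarieties/Lines/cm_pivot_andre.lean`, verbatim (unfolded). Immediate from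
the Literature theorem `map_mem_algebraicClasses_of_abelianVariety` (any morphism from a smooth projective
variety to an abelian variety; Kleiman moving-by-translates) at the smooth projective source `A`
(`AbelianVariety.isSmoothProjective_holds`).
[cite: Fulton1998, §19.2 Cor. 19.2 (b) and Appendix B.9.2 (a)] [cite: VoisinHodgeII2003, Prop. 9.21 (i)] -/
theorem stub_homPullback : HomPullback :=
  fun A B f _ _ ha ↦
    map_mem_algebraicClasses_of_abelianVariety (AbelianVariety.isSmoothProjective_holds (A := A)) B
      f.hom.hom.hom ha

/-- The same statement under a descriptive name, binders explicit (for importers: the notation above is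
file-local). [cite: Fulton1998, §19.2 Cor. 19.2 (b)] [cite: VoisinHodgeII2003, Prop. 9.21 (i)] -/
theorem map_mem_algebraicClasses_of_hom (A B : AbelianVariety ℂ) (f : A ⟶ B) {p : ℕ}
    {a : complexBetti B.X (2 * p)} (ha : a ∈ algebraicClasses B.X p) :
    complexBetti.map f.hom.hom.hom (2 * p) a ∈ algebraicClasses A.X p :=
  stub_homPullback A B f p a ha

end Summit.HodgeConjecture.HodgeConjecture.Theorems.HodgeAbelianVarieties.CMPivotAndre

end
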